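import Mathlib
import HarnessLib
import Literature.Analysis.FluidPDE.VectorCalculus
import Literature.Analysis.UnboundedOperators.HeatKernel
import Literature.Analysis.UnboundedOperators.HeatKernelGradient
import Summits.NavierStokesRegularity.NavierStokesRegularity.Theorems.LocalSineTubeDoorProfileAlignedWindowRigidityAncient
import Summits.NavierStokesRegularity.NavierStokesRegularity.Theorems.PoloidalWindowDoorPoloidalWindowRigidityClassSpaceTimeRates
import Summits.NavierStokesRegularity.NavierStokesRegularity.Theorems.HalfSpaceWindowDoorCirculationCarryingRigidityDefs

/-!
# Route `HalfSpaceWindowDoor`, crux `CirculationCarryingRigidity` (stmt-NavierStokesRegularity-25311) — stub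
# `stub_windowedFluxDecay : StubWindowedFluxDecay` of the skeleton of record (`CirculationCarryingRigidity_birth_v2_g3.lean`)

WINDOWED FLUX DECAY of a closed-hemisphere profile of the route's Type-I class: for every in-plane Gaussian window
`g_{L,a}` (width `L > 0`, centre `a`, unit mass), every height `c` and every `s < 0`,

  `∫_{ℝ²} ⟪curl v(s)(y₀,y₁,c), e₃⟫ g_{L,a}(y) dy ≤ K / (L √(−s))`,   `K = 4C`.

The estimate is KINEMATIC (a windowed Kelvin–Stokes circulation bound, no dynamics): on the plane `{x₂ = c}` the
`e₃`-component of the curl is the in-plane curl of the in-plane velocity, `ω₃ = ∂₀v₁ − ∂₁v₀` (partial derivatives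
along the plane chart `y ↦ (y₀,y₁,c)`), so by integration by parts on `ℝ²` (Mathlib's whole-space
`integral_mul_fderiv_eq_neg_fderiv_mul_of_integrable`)

  `∫ ω₃ g = −∫ v₁ ∂₀g + ∫ v₀ ∂₁g`,   `|∫ ω₃ g| ≤ 2 · sup‖v(s)‖ · ‖∇g_{L,a}‖_{L¹} ≤ 2 · (C/√(−s)) · (2/L)`,

using the Type-I rate `‖v(s)‖ ≤ C/√(−s)` and `‖∇G_t‖_{L¹(ℝ²)} ≤ 2 t^{−1/2}` for the two-dimensional heat kernel
`G_t` (`g_{L,a} = G_{L²}(· − a)`, tree `lintegral_enorm_fderiv_heatKernel_le`).  Integrability of all IBP integrands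
comes from the smoothness of the slices (`analyticOnNhd_slice`) and the class gradient bound `‖∇v(s)‖ ≤ K₁/(−s)`
(`exists_fderiv_rate_of_class'`); the sign hypothesis `⟪curl v, e₃⟫ ≥ 0` is used only to identify the lower Lebesgue
integral of the statement with the Bochner integral.  (The skeleton's docstring sketches a dynamic route — the windowed
Kelvin law integrated from `s₀ → −∞`; it is not needed for the registered signature.)

Seat ns-hsw-p1 (LEAD of 25311, cell pub-ns-dss).  WHAT THIS IS NOT: not a statement about Navier–Stokes regularity;
an a-priori bound for HYPOTHETICAL Type-I blow-up profiles (KNSS ancient mild solutions); lands `--supports` the crux.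
-/

noncomputable section

-- the summit and its single sub-problem share the name (CONVENTIONS §1), as in every Theorems file
set_option linter.dupNamespace false

namespace Summit.NavierStokesRegularity.NavierStokesRegularity.Theorems.HalfSpaceWindowDoorCirculationCarryingRigidityWindowedFlux

open MeasureTheory Set Function Filter Topology
open scoped RealInnerProductSpace InnerProductSpace ENNReal
open Literature.Analysis Literature.Analysis.FluidPDE Literature.Analysis.UnboundedOperators
open Summit.NavierStokesRegularity.NavierStokesRegularity.Theorems.HalfSpaceWindowDoorCirculationCarryingRigidityDefs
open Summit.NavierStokesRegularity.NavierStokesRegularity.Theorems.LocalSineTubeDoorProfileAlignedWindowRigidityAncient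
  (bdd_of_hasTypeITimeDecay analyticOnNhd_slice)
open Summit.NavierStokesRegularity.NavierStokesRegularity.Theorems.PoloidalWindowDoorPoloidalWindowRigidityClassSpaceTimeRates
  (exists_fderiv_rate_of_class')

/-! ### The Gaussian window is a translated two-dimensional heat kernel -/

section Window

variable {L : ℝ}

/-- `g_{L,a}(y) = G_{L²}(y − a)` with `G_t` the Gauss–Weierstrass kernel of `ℝ²` (`(4πt)^{−2/2} = (4πL²)⁻¹`). -/
theorem gaussWin_eq_heatKernel (L : ℝ) (a y : EuclideanSpace ℝ (Fin 2)) :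
    gaussWin L a y = heatKernel (L ^ 2) (y - a) := by
  rw [gaussWin, heatKernel, finrank_euclideanSpace_fin]
  have h : ((4 : ℝ) * Real.pi * L ^ 2) ^ (-((2 : ℕ) : ℝ) / 2) = (4 * Real.pi * L ^ 2)⁻¹ := by
    rw [show (-((2 : ℕ) : ℝ) / 2) = -1 by norm_num, Real.rpow_neg_one]
  rw [h, div_eq_inv_mul]

/-- The window as a function: `g_{L,a} = G_{L²}(· − a)`. -/
theorem gaussWin_eq_heatKernel' (L : ℝ) (a : EuclideanSpace ℝ (Fin 2)) :
    gaussWin L a = fun y => heatKernel (L ^ 2) (y - a) :=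
  funext (gaussWin_eq_heatKernel L a)

/-- The window is strictly positive. -/
theorem gaussWin_pos (hL : 0 < L) (a y : EuclideanSpace ℝ (Fin 2)) : 0 < gaussWin L a y := by
  rw [gaussWin_eq_heatKernel L]
  exact heatKernel_pos (by positivity) _

/-- The window is differentiable, with `∇g_{L,a}(y) = −(g_{L,a}(y)/(2L²)) (y − a)`. -/
theorem hasFDerivAt_gaussWin (L : ℝ) (a y : EuclideanSpace ℝ (Fin 2)) :
    HasFDerivAt (gaussWin L a) ((-(heatKernel (L ^ 2) (y - a) / (2 * L ^ 2))) • innerSL ℝ (y - a)) y := by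
  rw [gaussWin_eq_heatKernel' L]
  have h := (hasFDerivAt_heatKernel (L ^ 2) (y - a)).comp y ((hasFDerivAt_id y).sub_const a)
  rwa [ContinuousLinearMap.comp_id] at h

/-- The window is differentiable. -/
theorem differentiable_gaussWin (L : ℝ) (a : EuclideanSpace ℝ (Fin 2)) : Differentiable ℝ (gaussWin L a) :=
  fun y => (hasFDerivAt_gaussWin L a y).differentiableAt

/-- The window is continuous. -/
theorem continuous_gaussWin (L : ℝ) (a : EuclideanSpace ℝ (Fin 2)) : Continuous (gaussWin L a) :=
  (differentiable_gaussWin L a).continuous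

/-- The gradient of the window is the translated gradient of the heat kernel. -/
theorem fderiv_gaussWin_eq (L : ℝ) (a y : EuclideanSpace ℝ (Fin 2)) :
    fderiv ℝ (gaussWin L a) y = fderiv ℝ (heatKernel (L ^ 2)) (y - a) := by
  rw [(hasFDerivAt_gaussWin L a y).fderiv, (hasFDerivAt_heatKernel (L ^ 2) (y - a)).fderiv]

/-- The window is integrable on `ℝ²`. -/
theorem integrable_gaussWin (hL : 0 < L) (a : EuclideanSpace ℝ (Fin 2)) : Integrable (gaussWin L a) := by
  rw [gaussWin_eq_heatKernel' L]
  exact (integrable_heatKernel_holds (E := EuclideanSpace ℝ (Fin 2)) (t := L ^ 2) (by positivity)).comp_sub_right a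

/-- The gradient of the two-dimensional heat kernel is integrable, with `‖∇G_{L²}‖_{L¹} ≤ 2/L`. -/
theorem integrable_fderiv_heatKernel_two (hL : 0 < L) :
    Integrable (fun y : EuclideanSpace ℝ (Fin 2) => fderiv ℝ (heatKernel (L ^ 2)) y) ∧
      ∫ y : EuclideanSpace ℝ (Fin 2), ‖fderiv ℝ (heatKernel (L ^ 2)) y‖ ≤ 2 / L := by
  have hL2 : 0 < L ^ 2 := by positivity
  have hmeas : AEStronglyMeasurable (fun y : EuclideanSpace ℝ (Fin 2) => fderiv ℝ (heatKernel (L ^ 2)) y) volume :=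
    (continuous_fderiv_heatKernel (E := EuclideanSpace ℝ (Fin 2)) (L ^ 2)).aestronglyMeasurable
  have hle := lintegral_enorm_fderiv_heatKernel_le (E := EuclideanSpace ℝ (Fin 2)) hL2
  have hconst : (2 : ℝ) ^ ((Module.finrank ℝ (EuclideanSpace ℝ (Fin 2)) : ℝ) / 2) * (L ^ 2) ^ (-(1 / 2 : ℝ)) = 2 / L := by
    rw [finrank_euclideanSpace_fin, show (((2 : ℕ) : ℝ) / 2) = 1 by norm_num, Real.rpow_one,
      Real.rpow_neg hL2.le, ← Real.sqrt_eq_rpow, Real.sqrt_sq hL.le, div_eq_mul_inv]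
  rw [hconst] at hle
  refine ⟨⟨hmeas, ?_⟩, ?_⟩
  · exact lt_of_le_of_lt hle ENNReal.ofReal_lt_top
  · rw [integral_norm_eq_lintegral_enorm hmeas]
    exact ENNReal.toReal_le_of_le_ofReal (by positivity) hle

/-- The gradient of the window is integrable on `ℝ²`. -/
theorem integrable_fderiv_gaussWin (hL : 0 < L) (a : EuclideanSpace ℝ (Fin 2)) :
    Integrable (fun y => fderiv ℝ (gaussWin L a) y) := by
  have h := (integrable_fderiv_heatKernel_two hL).1.comp_sub_right a
  refine h.congr (Eventually.of_forall fun y => ?_)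
  exact (fderiv_gaussWin_eq L a y).symm

/-- **`‖∇g_{L,a}‖_{L¹(ℝ²)} ≤ 2/L`** (scale law of the window gradient). -/
theorem integral_norm_fderiv_gaussWin_le (hL : 0 < L) (a : EuclideanSpace ℝ (Fin 2)) :
    ∫ y, ‖fderiv ℝ (gaussWin L a) y‖ ≤ 2 / L := by
  have h := (integrable_fderiv_heatKernel_two hL).2
  have heq : (fun y => ‖fderiv ℝ (gaussWin L a) y‖) =
      fun y => (fun z => ‖fderiv ℝ (heatKernel (L ^ 2)) z‖) (y - a) :=
    funext fun y => by rw [fderiv_gaussWin_eq L a y]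
  rw [heq, integral_sub_right_eq_self (fun z : EuclideanSpace ℝ (Fin 2) => ‖fderiv ℝ (heatKernel (L ^ 2)) z‖) a]
  exact h

/-- A partial derivative of the window is dominated by the gradient norm: `|∂_w g(y)| ≤ ‖∇g(y)‖ ‖w‖`. -/
theorem abs_fderiv_gaussWin_apply_le (a y w : EuclideanSpace ℝ (Fin 2)) :
    |fderiv ℝ (gaussWin L a) y w| ≤ ‖fderiv ℝ (gaussWin L a) y‖ * ‖w‖ := by
  rw [← Real.norm_eq_abs]
  exact ContinuousLinearMap.le_opNorm _ _

end Window

/-! ### The plane chart `y ↦ (y₀, y₁, c)` and the plane components of a field -/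

section Plane

/-- The plane point in the standard frame: `(y₀, y₁, c) = y₀ • e₀ + y₁ • e₁ + c • e₂`. -/
theorem planePt_eq_sum (c : ℝ) (y : EuclideanSpace ℝ (Fin 2)) :
    planePt c y = (y 0) • EuclideanSpace.single 0 1 + (y 1) • EuclideanSpace.single 1 1 +
      c • EuclideanSpace.single 2 1 := by
  ext i
  fin_cases i <;> simp [planePt]

/-- **The plane chart is affine**, with derivative the constant map `proj₀ ⊗ e₀ + proj₁ ⊗ e₁`. -/
theorem hasFDerivAt_planePt (c : ℝ) (y : EuclideanSpace ℝ (Fin 2)) :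
    HasFDerivAt (planePt c)
      ((EuclideanSpace.proj 0 : EuclideanSpace ℝ (Fin 2) →L[ℝ] ℝ).smulRight (EuclideanSpace.single 0 (1 : ℝ) : EuclideanSpace ℝ (Fin 3)) +
        (EuclideanSpace.proj 1 : EuclideanSpace ℝ (Fin 2) →L[ℝ] ℝ).smulRight (EuclideanSpace.single 1 (1 : ℝ) : EuclideanSpace ℝ (Fin 3))) y := by
  have hfun : planePt c = fun y =>
      ((EuclideanSpace.proj 0 : EuclideanSpace ℝ (Fin 2) →L[ℝ] ℝ).smulRight (EuclideanSpace.single 0 (1 : ℝ) : EuclideanSpace ℝ (Fin 3)) +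
        (EuclideanSpace.proj 1 : EuclideanSpace ℝ (Fin 2) →L[ℝ] ℝ).smulRight (EuclideanSpace.single 1 (1 : ℝ) : EuclideanSpace ℝ (Fin 3))) y +
          c • EuclideanSpace.single 2 1 := by
    funext y
    rw [planePt_eq_sum]
    rfl
  rw [hfun]
  exact (ContinuousLinearMap.hasFDerivAt _).add_const _

/-- The chart derivative sends the frame of `ℝ²` into the horizontal frame of `ℝ³`: `eⱼ ↦ eⱼ` (`j = 0, 1`). -/
theorem planePtDeriv_apply_single (j : Fin 2) :
    ((EuclideanSpace.proj 0 : EuclideanSpace ℝ (Fin 2) →L[ℝ] ℝ).smulRight (EuclideanSpace.single 0 (1 : ℝ) : EuclideanSpace ℝ (Fin 3)) +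
        (EuclideanSpace.proj 1 : EuclideanSpace ℝ (Fin 2) →L[ℝ] ℝ).smulRight (EuclideanSpace.single 1 (1 : ℝ) : EuclideanSpace ℝ (Fin 3)))
      (EuclideanSpace.single j (1 : ℝ)) = EuclideanSpace.single (Fin.castSucc j) 1 := by
  fin_cases j <;> simp

/-- The plane chart is continuous. -/
theorem continuous_planePt (c : ℝ) : Continuous (planePt c) :=
  continuous_iff_continuousAt.2 fun y => (hasFDerivAt_planePt c y).continuousAt

variable {V : EuclideanSpace ℝ (Fin 3) → EuclideanSpace ℝ (Fin 3)}

/-- **Chain rule along the chart for a component**: for `V` differentiable,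
`∂_{yⱼ} [V(y₀,y₁,c)]ᵢ = (DV(y₀,y₁,c) eⱼ)ᵢ` (`j = 0, 1`, `i = 0, 1, 2`). -/
theorem fderiv_planeComp_apply (hV : Differentiable ℝ V) (c : ℝ) (i : Fin 3) (j : Fin 2)
    (y : EuclideanSpace ℝ (Fin 2)) :
    fderiv ℝ (fun y => V (planePt c y) i) y (EuclideanSpace.single j 1) =
      fderiv ℝ V (planePt c y) (EuclideanSpace.single (Fin.castSucc j) 1) i := by
  have hcomp : HasFDerivAt (fun y => V (planePt c y))
      ((fderiv ℝ V (planePt c y)).comp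
        ((EuclideanSpace.proj 0 : EuclideanSpace ℝ (Fin 2) →L[ℝ] ℝ).smulRight (EuclideanSpace.single 0 (1 : ℝ) : EuclideanSpace ℝ (Fin 3)) +
          (EuclideanSpace.proj 1 : EuclideanSpace ℝ (Fin 2) →L[ℝ] ℝ).smulRight (EuclideanSpace.single 1 (1 : ℝ) : EuclideanSpace ℝ (Fin 3)))) y :=
    (hV _).hasFDerivAt.comp y (hasFDerivAt_planePt c y)
  have hproj := (EuclideanSpace.proj (𝕜 := ℝ) i).hasFDerivAt.comp y hcomp
  have hfun : (fun y => V (planePt c y) i) = (EuclideanSpace.proj (𝕜 := ℝ) i) ∘ fun y => V (planePt c y) := rfl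
  rw [hfun, hproj.fderiv, ContinuousLinearMap.comp_apply, ContinuousLinearMap.comp_apply,
    planePtDeriv_apply_single]
  rfl

/-- The plane components of a differentiable field are differentiable. -/
theorem differentiable_planeComp (hV : Differentiable ℝ V) (c : ℝ) (i : Fin 3) :
    Differentiable ℝ (fun y => V (planePt c y) i) := by
  have h1 : Differentiable ℝ (fun y => V (planePt c y)) :=
    fun y => ((hV _).hasFDerivAt.comp y (hasFDerivAt_planePt c y)).differentiableAt
  exact (EuclideanSpace.proj (𝕜 := ℝ) i).differentiable.comp h1

/-- The plane components are continuous. -/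
theorem continuous_planeComp (hV : Continuous V) (c : ℝ) (i : Fin 3) :
    Continuous (fun y => V (planePt c y) i) :=
  (EuclideanSpace.proj (𝕜 := ℝ) i).continuous.comp (hV.comp (continuous_planePt c))

/-- The chart partial derivatives of the plane components are continuous when `DV` is. -/
theorem continuous_fderiv_planeComp_apply (hV : Differentiable ℝ V) (hVc : Continuous (fderiv ℝ V)) (c : ℝ)
    (i : Fin 3) (j : Fin 2) :
    Continuous (fun y => fderiv ℝ (fun y => V (planePt c y) i) y (EuclideanSpace.single j 1)) := by
  have hfun : (fun y => fderiv ℝ (fun y => V (planePt c y) i) y (EuclideanSpace.single j 1)) =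
      fun y => (EuclideanSpace.proj (𝕜 := ℝ) i)
        ((fderiv ℝ V (planePt c y)) (EuclideanSpace.single (Fin.castSucc j) 1)) := by
    funext y
    rw [fderiv_planeComp_apply hV c i j y]
    rfl
  rw [hfun]
  exact (EuclideanSpace.proj (𝕜 := ℝ) i).continuous.comp
    (((hVc.comp (continuous_planePt c)).clm_apply continuous_const))

/-- A plane component is bounded by the field: `|Vᵢ| ≤ ‖V‖`. -/
theorem abs_planeComp_le (c : ℝ) (i : Fin 3) (y : EuclideanSpace ℝ (Fin 2)) :
    |V (planePt c y) i| ≤ ‖V (planePt c y)‖ := by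
  rw [← Real.norm_eq_abs]
  exact PiLp.norm_apply_le (V (planePt c y)) i

/-- A chart partial derivative of a plane component is bounded by the gradient: `|∂ⱼVᵢ| ≤ ‖DV‖`. -/
theorem abs_fderiv_planeComp_apply_le (hV : Differentiable ℝ V) (c : ℝ) (i : Fin 3) (j : Fin 2)
    (y : EuclideanSpace ℝ (Fin 2)) :
    |fderiv ℝ (fun y => V (planePt c y) i) y (EuclideanSpace.single j 1)| ≤ ‖fderiv ℝ V (planePt c y)‖ := by
  rw [fderiv_planeComp_apply hV c i j y, ← Real.norm_eq_abs]
  refine (PiLp.norm_apply_le _ i).trans ?_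
  refine (ContinuousLinearMap.le_opNorm _ _).trans ?_
  rw [PiLp.norm_single, norm_one, mul_one]

/-- **The `e₃`-vorticity on the plane is the in-plane curl of the plane components**:
`⟪curl V (y₀,y₁,c), e₃⟫ = ∂₀[V(·)]₁ − ∂₁[V(·)]₀` at `y`. -/
theorem inner_curl_e3_eq (hV : Differentiable ℝ V) (c : ℝ) (y : EuclideanSpace ℝ (Fin 2)) :
    ⟪curl V (planePt c y), e3⟫_ℝ =
      fderiv ℝ (fun y => V (planePt c y) 1) y (EuclideanSpace.single 0 1) -
        fderiv ℝ (fun y => V (planePt c y) 0) y (EuclideanSpace.single 1 1) := by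
  rw [fderiv_planeComp_apply hV c 1 0 y, fderiv_planeComp_apply hV c 0 1 y, e3,
    EuclideanSpace.inner_single_right]
  simp [curl]

end Plane

/-! ### The windowed circulation bound for one slice -/

section Slice

variable {V : EuclideanSpace ℝ (Fin 3) → EuclideanSpace ℝ (Fin 3)}

/-- **Windowed Kelvin–Stokes bound (one slice).**  For a `C¹` field `V` on `ℝ³` with `‖V‖ ≤ B` and `‖DV‖ ≤ M`, every
`L > 0`, height `c` and centre `a`: the windowed `e₃`-vorticity `⟪curl V(y₀,y₁,c), e₃⟫ g_{L,a}(y)` is integrable on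
`ℝ²` and `|∫ ⟪curl V, e₃⟫ g_{L,a}| ≤ 4B/L` (integration by parts against the window, `‖∇g_{L,a}‖_{L¹} ≤ 2/L`). -/
theorem windowedCirculation_le (hV : Differentiable ℝ V) (hVc : Continuous (fderiv ℝ V)) {B M : ℝ}
    (hB : ∀ x, ‖V x‖ ≤ B) (hM : ∀ x, ‖fderiv ℝ V x‖ ≤ M) {L : ℝ} (hL : 0 < L) (c : ℝ)
    (a : EuclideanSpace ℝ (Fin 2)) :
    Integrable (fun y => ⟪curl V (planePt c y), e3⟫_ℝ * gaussWin L a y) ∧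
      |∫ y, ⟪curl V (planePt c y), e3⟫_ℝ * gaussWin L a y| ≤ 4 * B / L := by
  -- notation-free abbreviations: the plane components `f i` and the window `g`
  set f : Fin 3 → EuclideanSpace ℝ (Fin 2) → ℝ := fun i y => V (planePt c y) i with hf
  set g : EuclideanSpace ℝ (Fin 2) → ℝ := gaussWin L a with hg
  have hB0 : 0 ≤ B := (norm_nonneg _).trans (hB 0)
  have hVcont : Continuous V := hV.continuous
  have hf_diff : ∀ i, Differentiable ℝ (f i) := fun i => differentiable_planeComp hV c i
  have hf_cont : ∀ i, Continuous (f i) := fun i => continuous_planeComp hVcont c i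
  have hf_bdd : ∀ i y, ‖f i y‖ ≤ B := fun i y =>
    (Real.norm_eq_abs _).le.trans ((abs_planeComp_le c i y).trans (hB _))
  have hDf_cont : ∀ i j, Continuous (fun y => fderiv ℝ (f i) y (EuclideanSpace.single j 1)) :=
    fun i j => continuous_fderiv_planeComp_apply hV hVc c i j
  have hDf_bdd : ∀ i j y, ‖fderiv ℝ (f i) y (EuclideanSpace.single j 1)‖ ≤ M := fun i j y =>
    (Real.norm_eq_abs _).le.trans ((abs_fderiv_planeComp_apply_le hV c i j y).trans (hM _))
  have hg_int : Integrable g := integrable_gaussWin hL a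
  have hg_diff : Differentiable ℝ g := differentiable_gaussWin L a
  have hDg_int : Integrable (fun y => fderiv ℝ g y) := integrable_fderiv_gaussWin hL a
  have hDgj_int : ∀ j, Integrable (fun y => fderiv ℝ g y (EuclideanSpace.single j 1)) :=
    fun j => hDg_int.apply_continuousLinearMap _ |>.congr (Eventually.of_forall fun y => rfl)
  -- the three integrability conditions of the whole-space integration by parts
  have I1 : ∀ i j, Integrable (fun y => fderiv ℝ (f i) y (EuclideanSpace.single j 1) * g y) :=
    fun i j => hg_int.bdd_mul (hDf_cont i j).aestronglyMeasurable (ae_of_all _ (hDf_bdd i j))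
  have I2 : ∀ i j, Integrable (fun y => f i y * fderiv ℝ g y (EuclideanSpace.single j 1)) :=
    fun i j => (hDgj_int j).bdd_mul (hf_cont i).aestronglyMeasurable (ae_of_all _ (hf_bdd i))
  have I3 : ∀ i, Integrable (fun y => f i y * g y) :=
    fun i => hg_int.bdd_mul (hf_cont i).aestronglyMeasurable (ae_of_all _ (hf_bdd i))
  -- integration by parts: `∫ ∂ⱼfᵢ · g = −∫ fᵢ · ∂ⱼg`
  have IBP : ∀ i j, ∫ y, fderiv ℝ (f i) y (EuclideanSpace.single j 1) * g y =
      -∫ y, f i y * fderiv ℝ g y (EuclideanSpace.single j 1) := by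
    intro i j
    have h := integral_mul_fderiv_eq_neg_fderiv_mul_of_integrable (μ := volume) (I1 i j) (I2 i j) (I3 i)
      (fun y _ => hf_diff i y) (fun y _ => hg_diff y)
    rw [h, neg_neg]
  -- the bound on each boundary-free term: `|∫ fᵢ ∂ⱼg| ≤ B ‖∇g‖₁ ≤ 2B/L`
  have hterm : ∀ i j, |∫ y, f i y * fderiv ℝ g y (EuclideanSpace.single j 1)| ≤ B * (2 / L) := by
    intro i j
    have h1 : ‖∫ y, f i y * fderiv ℝ g y (EuclideanSpace.single j 1)‖ ≤ ∫ y, B * ‖fderiv ℝ g y‖ := by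
      refine norm_integral_le_of_norm_le (hDg_int.norm.const_mul B) (ae_of_all _ fun y => ?_)
      rw [norm_mul]
      refine mul_le_mul (hf_bdd i y) ?_ (norm_nonneg _) hB0
      have h2 := abs_fderiv_gaussWin_apply_le (L := L) a y (EuclideanSpace.single j 1)
      rw [PiLp.norm_single, norm_one, mul_one] at h2
      rwa [Real.norm_eq_abs]
    rw [Real.norm_eq_abs, integral_const_mul] at h1
    exact h1.trans (mul_le_mul_of_nonneg_left (integral_norm_fderiv_gaussWin_le hL a) hB0)
  -- the integrand is `∂₀f₁ · g − ∂₁f₀ · g`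
  have hident : (fun y => ⟪curl V (planePt c y), e3⟫_ℝ * gaussWin L a y) =
      fun y => fderiv ℝ (f 1) y (EuclideanSpace.single 0 1) * g y -
        fderiv ℝ (f 0) y (EuclideanSpace.single 1 1) * g y := by
    funext y
    rw [inner_curl_e3_eq hV c y, sub_mul]
  refine ⟨?_, ?_⟩
  · rw [hident]
    exact (I1 1 0).sub (I1 0 1)
  · rw [hident, integral_sub (I1 1 0) (I1 0 1), IBP 1 0, IBP 0 1, neg_sub_neg]
    have h10 := hterm 1 0
    have h01 := hterm 0 1
    calc |(∫ y, f 0 y * fderiv ℝ g y (EuclideanSpace.single 1 1)) -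
            ∫ y, f 1 y * fderiv ℝ g y (EuclideanSpace.single 0 1)|
        ≤ |∫ y, f 0 y * fderiv ℝ g y (EuclideanSpace.single 1 1)| +
            |∫ y, f 1 y * fderiv ℝ g y (EuclideanSpace.single 0 1)| := abs_sub _ _
      _ ≤ B * (2 / L) + B * (2 / L) := add_le_add h01 h10
      _ = 4 * B / L := by ring

end Slice

/-! ### The stub -/

/-- **Stub `stub_windowedFluxDecay` of the `CirculationCarryingRigidity` skeleton of record** (registered signature
`StubWindowedFluxDecay`, VERBATIM): every closed-hemisphere profile of the route's Type-I class (rate `C`, continuous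
on the open lower slab, unit-viscosity Oseen–Duhamel identity between negative times, divergence-free slices,
`⟪curl v(s), e₃⟫ ≥ 0`) has the windowed flux decay `∫ ⟪curl v(s)(y₀,y₁,c), e₃⟫ g_{L,a}(y) dy ≤ 4C/(L√(−s))` for all
`s < 0`, `L > 0`, `c`, `a` — the windowed Kelvin–Stokes bound `windowedCirculation_le` with `B = C/√(−s)`, the slices
being smooth (`analyticOnNhd_slice`) with bounded gradient (`exists_fderiv_rate_of_class'`). -/
theorem stub_windowedFluxDecay : StubWindowedFluxDecay := by
  intro C v hrate hcont hmild _hdiv hnn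
  have hC0 : 0 ≤ C := by
    have h := hrate (-1) (by norm_num) 0
    rw [neg_neg, Real.sqrt_one, div_one] at h
    exact (norm_nonneg _).trans h
  obtain ⟨K₁, -, hK₁⟩ := exists_fderiv_rate_of_class' hrate hcont hmild
  refine ⟨4 * C, by positivity, fun s hs L hL c a => ?_⟩
  -- the slice `v s` is smooth with bounded gradient and Type-I size
  have hA : AnalyticOnNhd ℝ (v s) univ := analyticOnNhd_slice hcont (bdd_of_hasTypeITimeDecay hrate) hmild hs
  have hVd : Differentiable ℝ (v s) := fun x => (hA x (mem_univ x)).differentiableAt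
  have hVc : Continuous (fderiv ℝ (v s)) := continuousOn_univ.1 hA.fderiv.continuousOn
  have hB : ∀ x, ‖v s x‖ ≤ C / Real.sqrt (-s) := fun x => hrate s hs x
  obtain ⟨hint, hle⟩ := windowedCirculation_le hVd hVc hB (hK₁ s hs) hL c a
  -- the integrand is nonnegative (closed hemisphere), so the lower integral is the Bochner integral
  have hnn' : 0 ≤ᵐ[volume] fun y => ⟪curl (v s) (planePt c y), e3⟫_ℝ * gaussWin L a y :=
    ae_of_all _ fun y => mul_nonneg (hnn s hs _) (gaussWin_pos hL a y).le
  rw [← ofReal_integral_eq_lintegral_ofReal hint hnn']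
  refine ENNReal.ofReal_le_ofReal ((le_abs_self _).trans (hle.trans (le_of_eq ?_)))
  have hsq : 0 < Real.sqrt (-s) := Real.sqrt_pos.2 (neg_pos.2 hs)
  field_simp

end Summit.NavierStokesRegularity.NavierStokesRegularity.Theorems.HalfSpaceWindowDoorCirculationCarryingRigidityWindowedFlux

end
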